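import Literature.Computation.Certificates.PosSemidef

/-!
# Integer (scaled) rounded PSD certificates — the cheap kernel path

Compute-infrastructure file (unit `infra-psd-sos-lp-checker`), a companion of `PosSemidef.lean`.
Rounded certificate data are naturally SCALED INTEGERS (a floating-point factor rounded to `10⁻⁶`
is an integer matrix over `10⁶`), and positive semidefiniteness is invariant under positive
scaling. Checking in `ℤ` instead of `ℚ` avoids all `gcd` normalisations and the proof fields of
kernel `ℚ` values: measured 2026-08-16 on the farm, a rounded Gram certificate of size `35` takes
≈ 30 s in `ℤ` where the `ℚ` form already exceeds the kernel memory cap of one `decide +kernel`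
(`PosSemidef.lean`, `Blocks.lean`); size `60` in `ℤ` needs block splitting too.

Data: an INTEGER matrix `A : Matrix (Fin n) (Fin n) ℤ`, natural weights `d : Fin m → ℕ` and an
integer factor `B : Matrix (Fin m) (Fin n) ℤ`; the certificate `IsGramCertZ A d B` says that the
integer residual `A − Bᵀ·diag d·B` is symmetric diagonally dominant with nonnegative diagonal.
Consequences: the quadratic form of `A` (cast into any linearly ordered field) is nonnegative,
`(A.map Int.cast).PosSemidef`, and — for a RATIONAL matrix `Aq` with `A = c • Aq`, `0 < c`
(an entrywise decidable side condition) — the same for `Aq`.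

## API (namespace `Literature.Computation.Certificates.PSD`)

* `gramResidualZ`, `IsDiagDominantZ` (+ `.intro`, `.map_cast`, `.quadForm_nonneg`),
  `IsGramCertZ` (+ `.quadForm_nonneg`, `.quadForm_nonneg'`, `.dotProduct_mulVec_nonneg`, `.isSymm`,
  `.posSemidef`, and the rational bridge `.quadForm_nonneg_of_smul`, `.posSemidef_of_smul`).
* Kernel-checked `example`s at the end. Block splitting: `Certificates/Blocks.lean`.

[folklore] throughout (Gershgorin; Blekherman–Parrilo–Thomas 2012, App. A.1.2 for the Gram part).
-/

namespace Literature.Computation.Certificates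

namespace PSD

open Finset Matrix

variable {n m : ℕ}
variable {R : Type*} [Field R] [LinearOrder R] [IsStrictOrderedRing R]

/-- The integer residual `A − Bᵀ·diag d·B`. [folklore] -/
def gramResidualZ (A : Matrix (Fin n) (Fin n) ℤ) (d : Fin m → ℕ) (B : Matrix (Fin m) (Fin n) ℤ) :
    Matrix (Fin n) (Fin n) ℤ :=
  fun i j => A i j - ∑ k, (d k : ℤ) * (B k i * B k j)

/-- Symmetric diagonal dominance with nonnegative diagonal, integer version. Decidable.
[folklore] -/
def IsDiagDominantZ (M : Matrix (Fin n) (Fin n) ℤ) : Prop :=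
  (∀ i j, M i j = M j i) ∧ ∀ i, ∑ j ∈ Finset.univ.erase i, |M i j| ≤ M i i

/-- Decidability of `IsDiagDominantZ`. [folklore] -/
instance IsDiagDominantZ.instDecidable (M : Matrix (Fin n) (Fin n) ℤ) :
    Decidable (IsDiagDominantZ M) :=
  inferInstanceAs
    (Decidable ((∀ i j, M i j = M j i) ∧ ∀ i, ∑ j ∈ Finset.univ.erase i, |M i j| ≤ M i i))

/-- **Integer rounded Gram certificate**: the residual `A − Bᵀ·diag d·B` is symmetric diagonally
dominant (the weights `d` are naturals, so no sign condition is needed). Decidable; the cheap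
kernel path. [folklore] -/
def IsGramCertZ (A : Matrix (Fin n) (Fin n) ℤ) (d : Fin m → ℕ) (B : Matrix (Fin m) (Fin n) ℤ) :
    Prop :=
  IsDiagDominantZ (gramResidualZ A d B)

/-- Decidability of `IsGramCertZ`. [folklore] -/
instance IsGramCertZ.instDecidable (A : Matrix (Fin n) (Fin n) ℤ) (d : Fin m → ℕ)
    (B : Matrix (Fin m) (Fin n) ℤ) : Decidable (IsGramCertZ A d B) :=
  inferInstanceAs (Decidable (IsDiagDominantZ (gramResidualZ A d B)))

namespace IsDiagDominantZ

variable {M : Matrix (Fin n) (Fin n) ℤ}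

/-- Assemble integer diagonal dominance from symmetry and the row inequalities (each may be a
block-split `decide +kernel`). [folklore] -/
theorem intro (hs : ∀ i j, M i j = M j i) (hr : ∀ i, ∑ j ∈ Finset.univ.erase i, |M i j| ≤ M i i) :
    IsDiagDominantZ M :=
  ⟨hs, hr⟩

/-- Integer diagonal dominance survives the cast to `ℚ`. [folklore] -/
theorem map_cast (h : IsDiagDominantZ M) : IsDiagDominant (M.map (Int.cast : ℤ → ℚ)) := by
  refine ⟨fun i j => ?_, fun i => ?_⟩
  · simp only [Matrix.map_apply, h.1 i j]
  · have := h.2 i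
    simp only [Matrix.map_apply]
    exact_mod_cast this

/-- **Gershgorin, integer data**: the quadratic form of a symmetric diagonally dominant integer
matrix with nonnegative diagonal is nonnegative over any linearly ordered field. [folklore] -/
theorem quadForm_nonneg (h : IsDiagDominantZ M) (x : Fin n → R) :
    0 ≤ ∑ i, ∑ j, x i * (M i j : R) * x j := by
  have h1 := h.map_cast.quadForm_nonneg (R := R) x
  simpa only [Matrix.map_apply, Rat.cast_intCast] using h1

end IsDiagDominantZ

namespace IsGramCertZ

variable {A : Matrix (Fin n) (Fin n) ℤ} {d : Fin m → ℕ} {B : Matrix (Fin m) (Fin n) ℤ}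

/-- A matrix with an integer rounded Gram certificate is symmetric. [folklore] -/
theorem isSymm (h : IsGramCertZ A d B) : A.IsSymm :=
  Matrix.IsSymm.ext fun i j => by
    have h1 : gramResidualZ A d B j i = gramResidualZ A d B i j := h.1 j i
    simp only [gramResidualZ] at h1
    have h2 : ∑ k, (d k : ℤ) * (B k j * B k i) = ∑ k, (d k : ℤ) * (B k i * B k j) :=
      Finset.sum_congr rfl fun k _ => by ring
    linarith

/-- **Soundness (quadratic form)** of integer rounded Gram certificates:
`xᵀ A x = ∑ d (Bx)² + xᵀ R x ≥ 0`. [folklore] -/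
theorem quadForm_nonneg (h : IsGramCertZ A d B) (x : Fin n → R) :
    0 ≤ ∑ i, ∑ j, x i * (A i j : R) * x j := by
  have hG : IsGramCert (fun i j => ((∑ k, (d k : ℤ) * (B k i * B k j) : ℤ) : ℚ))
      (fun k => (d k : ℚ)) (B.map (Int.cast : ℤ → ℚ)) :=
    ⟨fun k => (Nat.cast_nonneg (d k) : (0 : ℚ) ≤ (d k : ℚ)), fun i j => by push_cast [Matrix.map_apply]; rfl⟩
  have h1 : 0 ≤ ∑ i, ∑ j, x i * ((((∑ k, (d k : ℤ) * (B k i * B k j) : ℤ) : ℚ) : ℚ) : R) * x j :=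
    hG.quadForm_nonneg x
  have h2 := IsDiagDominantZ.quadForm_nonneg h x
  have h3 : ∀ i j, (A i j : R) =
      ((((∑ k, (d k : ℤ) * (B k i * B k j) : ℤ) : ℚ) : ℚ) : R) + ((gramResidualZ A d B i j : ℤ) : R) := by
    intro i j
    rw [Rat.cast_intCast, ← Int.cast_add]
    congr 1
    simp [gramResidualZ]
  simp_rw [h3, mul_add, add_mul, Finset.sum_add_distrib]
  exact add_nonneg h1 h2

/-- The `x i * x j * A i j` arrangement. [folklore] -/
theorem quadForm_nonneg' (h : IsGramCertZ A d B) (x : Fin n → R) :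
    0 ≤ ∑ i, ∑ j, x i * x j * (A i j : R) := by
  convert h.quadForm_nonneg x using 2 with i _
  exact Finset.sum_congr rfl fun j _ => by ring

/-- `0 ≤ x ⬝ᵥ (A.map cast *ᵥ x)`. [folklore] -/
theorem dotProduct_mulVec_nonneg (h : IsGramCertZ A d B) (x : Fin n → R) :
    0 ≤ x ⬝ᵥ (A.map (Int.cast : ℤ → R) *ᵥ x) := by
  convert h.quadForm_nonneg x using 1
  simp only [dotProduct, Matrix.mulVec, Matrix.map_apply, Finset.mul_sum, mul_assoc]

/-- **Soundness (`Matrix.PosSemidef`)**: the cast integer matrix is positive semidefinite over any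
linearly ordered field with trivial star (e.g. `ℝ`). [folklore] -/
theorem posSemidef [StarRing R] [TrivialStar R] (h : IsGramCertZ A d B) :
    (A.map (Int.cast : ℤ → R)).PosSemidef :=
  Matrix.PosSemidef.of_dotProduct_mulVec_nonneg
    (Matrix.isHermitian_iff_isSymm.2 (h.isSymm.map _))
    fun x => by simpa only [star_trivial] using h.dotProduct_mulVec_nonneg x

/-- **Rational bridge (quadratic form)**: if `A = c • Aq` entrywise with `0 < c`, the quadratic
form of the RATIONAL matrix `Aq` is nonnegative as well (PSD is invariant under positive
scaling; the side condition `∀ i j, (A i j : ℚ) = c * Aq i j` is decidable). [folklore] -/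
theorem quadForm_nonneg_of_smul (h : IsGramCertZ A d B) {c : ℚ} (hc : 0 < c)
    {Aq : Matrix (Fin n) (Fin n) ℚ} (hA : ∀ i j, (A i j : ℚ) = c * Aq i j) (x : Fin n → R) :
    0 ≤ ∑ i, ∑ j, x i * (Aq i j : R) * x j := by
  have h1 := h.quadForm_nonneg x
  have h2 : ∀ i j, (A i j : R) = (c : R) * (Aq i j : R) := fun i j => by
    rw [← Rat.cast_mul, ← hA i j, Rat.cast_intCast]
  simp_rw [h2] at h1
  have h3 : ∑ i, ∑ j, x i * ((c : R) * (Aq i j : R)) * x j =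
      (c : R) * ∑ i, ∑ j, x i * (Aq i j : R) * x j := by
    rw [Finset.mul_sum]
    refine Finset.sum_congr rfl fun i _ => ?_
    rw [Finset.mul_sum]
    exact Finset.sum_congr rfl fun j _ => by ring
  rw [h3] at h1
  have hc' : (0 : R) < c := by exact_mod_cast hc
  exact nonneg_of_mul_nonneg_right (by simpa [mul_comm] using h1) hc'

/-- **Rational bridge (`Matrix.PosSemidef`)** for `Aq` with `A = c • Aq`, `0 < c`. [folklore] -/
theorem posSemidef_of_smul [StarRing R] [TrivialStar R] (h : IsGramCertZ A d B) {c : ℚ}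
    (hc : 0 < c) {Aq : Matrix (Fin n) (Fin n) ℚ} (hA : ∀ i j, (A i j : ℚ) = c * Aq i j) :
    (Aq.map (Rat.cast : ℚ → R)).PosSemidef := by
  have hsymm : Aq.IsSymm := Matrix.IsSymm.ext fun i j => by
    have h1 := hA i j
    have h2 := hA j i
    have h3 : A j i = A i j := h.isSymm.apply i j
    rw [h3, h1] at h2
    exact (mul_left_cancel₀ hc.ne' h2).symm
  refine Matrix.PosSemidef.of_dotProduct_mulVec_nonneg
    (Matrix.isHermitian_iff_isSymm.2 (hsymm.map _)) fun x => ?_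
  have h1 := h.quadForm_nonneg_of_smul hc hA x
  simp only [star_trivial]
  convert h1 using 1
  simp only [dotProduct, Matrix.mulVec, Matrix.map_apply, Finset.mul_sum, mul_assoc]

end IsGramCertZ

/-! ### Tests / usage templates (kernel-checked) -/

/-- Test: `A = [[200,-100,0],[-100,200,-100],[0,-100,200]]` (`= 100 •` the path Laplacian-like
matrix) with the integer factor `B = [[10, -5, 0], [0, 10, -7], [0, 0, 10]]`, `d = (2, 1, 1)`:
residual `[[0,0,0],[0,50,-30],[0,-30,51]]` is diagonally dominant, hence PSD over `ℝ`. -/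
example : ((!![200, -100, 0; -100, 200, -100; 0, -100, 200] : Matrix (Fin 3) (Fin 3) ℤ).map
    (Int.cast : ℤ → ℝ)).PosSemidef := by
  refine IsGramCertZ.posSemidef (d := ![2, 1, 1]) (B := !![10, -5, 0; 0, 10, -7; 0, 0, 10]) ?_
  decide +kernel

/-- Test (rational bridge): the same certificate proves the RATIONAL matrix
`Aq = [[2,-1,0],[-1,2,-1],[0,-1,2]]` PSD over `ℝ` via `A = 100 • Aq`. -/
example : ((!![2, -1, 0; -1, 2, -1; 0, -1, 2] : Matrix (Fin 3) (Fin 3) ℚ).map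
    (Rat.cast : ℚ → ℝ)).PosSemidef := by
  refine IsGramCertZ.posSemidef_of_smul
    (A := !![200, -100, 0; -100, 200, -100; 0, -100, 200]) (d := ![2, 1, 1])
    (B := !![10, -5, 0; 0, 10, -7; 0, 0, 10]) (c := 100) ?_ (by norm_num) ?_
  · decide +kernel
  · decide +kernel

end PSD

end Literature.Computation.Certificates
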